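import Literature.AlgebraicGeometry.Frobenioids.ArithmeticDivisorsUnits
import Literature.AlgebraicGeometry.Frobenioids.LogPrimesLinearIndependent
import Literature.AlgebraicGeometry.Frobenioids.QuasiTemperoid

/-!
# Kernel DAG index — layer L1, part e (MACHINE DELTA-DRAFT by abc-iut-dag `tools/mkkernel.py` @2026-08-25T20:07Z: 5 landed nodes NOT YET in the tree index Summits/ABC/IUTFork/DAG*.lean filed by abc-iut-c312-2; spec v1.3)

THIS FILE PROVES NOTHING NEW AND ASSERTS NOTHING (plan/KERNEL-DAG-SPEC.md). It gives ONE NAME `N_<kernel_id>` to each DAG node whose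
statement has LANDED through the gate, knitting the landed declarations BY NAME. Witness naming (c312-2 F1/F2, 18:39:37Z): `N_<id>_holds`
exists iff the DAG row is `discharged(p)` (it IS the kernel-checked theorems); a landed row not yet marked discharged by its lead gets the same
conjunction witnessed as `N_<id>_part`; FACT-style `def … : Prop` claims get a name and no witness; CLAIM-FORM items ([IUTchIII] Cor 3.12,
[IUTchIV] Thm 1.10) are `abbrev N_<id> (X) : Prop := X.<Claim>` and the theorems that assume them are EDGES `E_<dst>_of_<src>` (no `__`). Nothing here says abc is proved or refuted or takes a side on [IUTchIII] Cor 3.12. typed ≠ discharged; indexed ≠ endorsed.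
Filer of the tree copy: abc-iut-c312-2 (`Summits/ABC/IUTFork/DAGL1e.lean`); this draft is regenerated hourly and is not the tree.
FILED COPY (filed by abc-iut-c312-8 for the index owner abc-iut-c312-2, WAVE2-SLICES row 78; post-processed by c312-2's fixdraft.py): claim nodes are claim-form abbrevs without `_holds`;
`_holds` only for DAG rows marked discharged, `_part` otherwise (spec §2(b),(c)); edges by name (§3).
-/

namespace Summit.ABC.IUTFork.DAG

namespace PartL1e
/-- `StatementOf h` is the statement (a `Prop`) of which the landed `h` is the proof: the index NAMES statements, it never re-types them. -/
abbrev StatementOf {P : Prop} (_h : P) : Prop := P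
end PartL1e
open PartL1e

noncomputable section
universe u₁ u₂ u₃ u₄ u₅ u₆ u₇ u₈ u₉

/-- [node FrdI:Ex6.3 · L1/D1 · [FrdI] Ex 6.3, kurims p.112 · p404170 · claim · DAG status landed(p403788)] decls 4 · cites→ FrdI:Thm5.2 -/
def N_FrdI_Ex6_3 : Prop :=
  StatementOf @Literature.AlgebraicGeometry.Frobenioids.finitePlace_apply_eq_one_of_div_eq_zero.{u₁} ∧
  StatementOf @Literature.AlgebraicGeometry.Frobenioids.infinitePlace_apply_eq_one_of_div_eq_zero.{u₁} ∧
  StatementOf @Literature.AlgebraicGeometry.Frobenioids.mem_range_algebraMap_of_finitePlace_eq_one.{u₁} ∧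
  StatementOf @Literature.AlgebraicGeometry.Frobenioids.principalArithDivisor_eq_zero_iff.{u₁}
/-- partial witness (DAG row not marked discharged) of `N_FrdI_Ex6_3`: the landed theorems it names, BY NAME (spec §2(c)); proves nothing new. -/
theorem N_FrdI_Ex6_3_part : N_FrdI_Ex6_3 := ⟨@Literature.AlgebraicGeometry.Frobenioids.finitePlace_apply_eq_one_of_div_eq_zero, @Literature.AlgebraicGeometry.Frobenioids.infinitePlace_apply_eq_one_of_div_eq_zero, @Literature.AlgebraicGeometry.Frobenioids.mem_range_algebraMap_of_finitePlace_eq_one, @Literature.AlgebraicGeometry.Frobenioids.principalArithDivisor_eq_zero_iff⟩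

/-- [node FrdI:Lem6.5(i) · L1/D1 · [FrdI] Lem 6.5 (i), kurims p.116 · p404473 · claim · DAG status landed(p404473)] decls 2 · cites→ - -/
def N_FrdI_Lem6_5_i : Prop :=
  StatementOf @Literature.AlgebraicGeometry.Frobenioids.linearIndependent_int_log_primes ∧
  StatementOf @Literature.AlgebraicGeometry.Frobenioids.linearIndependent_rat_log_primes
/-- partial witness (DAG row not marked discharged) of `N_FrdI_Lem6_5_i`: the landed theorems it names, BY NAME (spec §2(c)); proves nothing new. -/
theorem N_FrdI_Lem6_5_i_part : N_FrdI_Lem6_5_i := ⟨@Literature.AlgebraicGeometry.Frobenioids.linearIndependent_int_log_primes, @Literature.AlgebraicGeometry.Frobenioids.linearIndependent_rat_log_primes⟩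

/-- [node FrdII:Ex1.3(i) · L1/D1 · [FrdII] Ex 1.3 (i), kurims p.10 · p404448 · claim · DAG status landed(p404448)] decls 13 · cites→ FrdII:Ex1.1,FrdII:Rmk3.4.1,FrdII:Thm1.2 -/
def N_FrdII_Ex1_3_i : Prop :=
  StatementOf @Literature.AlgebraicGeometry.Frobenioids.QuasiTemperoid.isOfFSMType_of_mono_isIso.{u₁, u₂} ∧
  StatementOf @Literature.AlgebraicGeometry.Frobenioids.QuasiTemperoid.connectedPartIsOfFSMFFType_of.{u₁}
/-- partial witness (DAG row not marked discharged) of `N_FrdII_Ex1_3_i`: the landed theorems it names, BY NAME (spec §2(c)); proves nothing new. -/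
theorem N_FrdII_Ex1_3_i_part : N_FrdII_Ex1_3_i := ⟨@Literature.AlgebraicGeometry.Frobenioids.QuasiTemperoid.isOfFSMType_of_mono_isIso, @Literature.AlgebraicGeometry.Frobenioids.QuasiTemperoid.connectedPartIsOfFSMFFType_of⟩
example := @Literature.AlgebraicGeometry.Frobenioids.QuasiTemperoid.cosetAction.{u₁}
example := @Literature.AlgebraicGeometry.Frobenioids.QuasiTemperoid.admitsHomToCoset.{u₁}
example := @Literature.AlgebraicGeometry.Frobenioids.QuasiTemperoid.BTempRel.{u₁}
example := @Literature.AlgebraicGeometry.Frobenioids.QuasiTemperoid.ConnectedPartEquivOfProfinite.{u₁}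
example := @Literature.AlgebraicGeometry.Frobenioids.QuasiTemperoid.InductionEquivalence.{u₁}
example := @Literature.AlgebraicGeometry.Frobenioids.QuasiTemperoid.IsConnectedQuasiTemperoid.{u₁, u₂, u₃}

/-- [node FrdII:Ex1.3(ii) · L1/D1 · [FrdII] Ex 1.3 (ii), kurims p.10 · p404448 · claim · DAG status landed(p404448)] decls 3 · cites→ FrdII:Ex1.1,FrdII:Rmk3.4.1,FrdII:Thm1.2 -/
abbrev N_FrdII_Ex1_3_ii : Prop := StatementOf @Literature.AlgebraicGeometry.Frobenioids.QuasiTemperoid.IsOpenHom.isOpen_range.{u₁}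
/-- partial witness (DAG row not marked discharged) of `N_FrdII_Ex1_3_ii`: the landed theorems it names, BY NAME (spec §2(c)); proves nothing new. -/
theorem N_FrdII_Ex1_3_ii_part : N_FrdII_Ex1_3_ii := @Literature.AlgebraicGeometry.Frobenioids.QuasiTemperoid.IsOpenHom.isOpen_range
example := @Literature.AlgebraicGeometry.Frobenioids.QuasiTemperoid.IsOpenHom.{u₁}
example := @Literature.AlgebraicGeometry.Frobenioids.QuasiTemperoid.PushforwardFunctor.{u₁}

/-- [node FrdII:Ex1.3(iii) · L1/D1 · [FrdII] Ex 1.3 (iii), kurims p.10 · p404448 · data] decls 1 · cites→ FrdII:Ex1.1,FrdII:Rmk3.4.1,FrdII:Thm1.2 -/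
abbrev N_FrdII_Ex1_3_iii := @Literature.AlgebraicGeometry.Frobenioids.QuasiTemperoid.GaloisBaseFunctor.{u₁}

end

end Summit.ABC.IUTFork.DAG
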